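import Literature.AlgebraicGeometry.RelativeSpec.GeometricQuotient
import Literature.RingTheory.GaloisAlgebras.ChaseHarrisonRosenbergTorsor
import Mathlib.RingTheory.Etale.Descent
import Mathlib.RingTheory.Etale.Pi
import Mathlib.RingTheory.Flat.FaithfullyFlat.Algebra
import Mathlib.AlgebraicGeometry.Morphisms.Etale
import Mathlib.AlgebraicGeometry.Morphisms.Finite
import HarnessLib

/-!
# A finite geometric quotient of an integral scheme by a faithful finite group action is
# generically étale

Route `ResolutionOfSingularities/WildQuotients`, support items `GaloisReduction`
(stmt-ResolutionOfSingularities-15641) and `GaloisQuotientAlteration`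
(stmt-ResolutionOfSingularities-16323). The route types de Jong's Galois alteration `X′ → X`
(de Jong 1997, Thm. 5.13 / Cor. 5.15) through its quotient `q : X′ → X₁ = X′/G` and asks, among
the hypotheses of the crux `WildQuotientResolution`, that `q` be **étale over a dense open of
`X₁`**. This is not part of the printed theorem; it holds because `G` may be replaced by its
faithful image (SGA 1, Exp. V, Prop. 2.6 / Cor. 2.4: the quotient map is étale at the points of
trivial inertia). This file PROVES it for the tree's notion of geometric quotient
(`Literature.AlgebraicGeometry.RelativeSpec.ActionOver.IsGeometricQuotient`, Mumford, *Abelian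
Varieties*, §7, Thm. p. 66 (1)–(2)):

* the action is viewed over the `G`-invariant `q` itself (`ActionOver.mk ρ.aut _ :
  ActionOver q G`), so that the chart algebra `ActionOver.act`, `mulSemiringAction`, `map_act`,
  `act_app` of `…RelativeSpec.FiniteGroupQuotient` applies to the opens `q⁻¹W`;
* `isInvariant_app`, `faithfulSMul_app`, `smulCommClass_app` — over every open `W ⊆ X₁`,
  `q♯ : Γ(X₁, W) → Γ(X′, q⁻¹W)` is injective onto the `G`-invariants (Mumford's (2));
* `act_ne_id` — for a FAITHFUL action on an integral separated `X′`, every `g ≠ 1` moves some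
  section over any non-empty affine `G`-stable chart `q⁻¹W` (a morphism to an affine scheme is
  determined by global sections, and automorphisms of a reduced scheme agreeing on a dense open
  into a separated scheme are equal);
* `exists_invariant_mem_augIdeal` — hence a non-zero INVARIANT section `b₀` lying in every
  augmentation ideal `I_g = (g • b - b)`, `g ≠ 1`;
* `augIdeal_eq_top_basicOpen` — on the basic open `W' = D(a₀)`, `q♯ a₀ = b₀`, the action on
  `Γ(X′, q⁻¹W')` is free (`I_g = (1)` for `g ≠ 1`);
* `etale_app_basicOpen`, `etale_morphismRestrict_basicOpen` — so `q♯` is étale there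
  (Chase–Harrison–Rosenberg, `Literature.RingTheory.GaloisAlgebras.etale_of_free`, re-derived
  here as `etale_of_free'` — see the note in the CHR section) and
  `q ∣_ W'` is étale;
* `exists_dense_etale_morphismRestrict` — **`q` is étale over a dense open of `X₁`**.
-/

-- single-problem summit: the doubled namespace component `ResolutionOfSingularities` is forced
set_option linter.dupNamespace false

noncomputable section

open CategoryTheory Limits AlgebraicGeometry
open scoped Pointwise

namespace Summit.ResolutionOfSingularities.ResolutionOfSingularities.Theorems

/-! ### Chase–Harrison–Rosenberg: a free action gives an étale extension of the invariants

This is `Literature.RingTheory.GaloisAlgebras.etale_of_free`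
(`…GaloisAlgebras.ChaseHarrisonRosenbergEtale`), re-derived verbatim from
`…ChaseHarrisonRosenbergTorsor` because that module's build has not landed on the hub (its
`.olean` is missing since 2026-08-15, so it cannot be imported; TODO: import it and delete this
section once the hub build catches up). -/

section CHR

open scoped TensorProduct

variable (A : Type*) {B : Type*} [CommRing A] [CommRing B] [Algebra A B]
variable (G : Type*) [Group G] [MulSemiringAction G B] [SMulCommClass G A B]
variable [Fintype G] [Algebra.IsInvariant A B G] [FaithfulSMul A B]

/-- **A Galois extension of commutative rings is étale** (Chase–Harrison–Rosenberg; SGA 1, V,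
Prop. 2.6): for a free action (`(g • b - b : b) = (1)` for `g ≠ 1`) with `B^G = A ⊆ B`, `A → B`
is faithfully flat (`Literature.RingTheory.GaloisAlgebras.flat_of_free` and integrality) and
`B ⊗_A B ≅ ∏_G B` (`…canonicalEquiv`) is étale over `B`, so étaleness descends (Mathlib
`Algebra.Etale.of_etale_tensorProduct_of_faithfullyFlat`). Copy of
`Literature.RingTheory.GaloisAlgebras.etale_of_free`. [cite: SGA1, Exp. V, Prop. 2.6]
[cite: Greither1992CyclicGalois, Ch. 0 Thm. 1.6 (pp. 3–4)] -/
theorem etale_of_free'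
    (hfree : ∀ g : G, g ≠ 1 → Ideal.span (Set.range fun b : B => g • b - b) = ⊤) :
    Algebra.Etale A B := by
  haveI := Literature.RingTheory.GaloisAlgebras.flat_of_free A G (B := B) hfree
  haveI : Algebra.IsIntegral A B := Algebra.IsInvariant.isIntegral A B G
  haveI : Module.FaithfullyFlat A B :=
    Module.FaithfullyFlat.of_comap_surjective (Algebra.IsIntegral.comap_surjective A B)
  -- the torsor isomorphism `B ⊗_A B ≃ (G → B)`, `x ⊗ y ↦ (x · g(y))_g`, is `B`-linear for the
  -- `B`-algebra structure on the LEFT factor and the diagonal one on `G → B`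
  let e : B ⊗[A] B ≃ₐ[B] (G → B) :=
    AlgEquiv.ofRingEquiv
      (f := (Literature.RingTheory.GaloisAlgebras.canonicalEquiv A G hfree).toRingEquiv) fun x => by
      change Literature.RingTheory.GaloisAlgebras.canonicalEquiv A G hfree
          (algebraMap B (B ⊗[A] B) x) = algebraMap B (G → B) x
      rw [Literature.RingTheory.GaloisAlgebras.canonicalEquiv_apply,
        Algebra.TensorProduct.algebraMap_apply, Algebra.algebraMap_self, RingHom.id_apply]
      funext g
      rw [Literature.RingTheory.GaloisAlgebras.canonicalMap_tmul, smul_one, mul_one]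
      rfl
  haveI : Algebra.Etale B (B ⊗[A] B) := Algebra.Etale.of_equiv e.symm
  exact Algebra.Etale.of_etale_tensorProduct_of_faithfullyFlat B

end CHR

open Literature.AlgebraicGeometry.RelativeSpec

universe u

variable {X' X Q : Scheme.{u}} {π : X' ⟶ X} {G : Type u} [Group G] (ρ : ActionOver π G)
  {q : X' ⟶ Q}

section Invariants

/-- **Mumford's condition (2) as `Algebra.IsInvariant`**: over every open `W ⊆ Q` of a geometric
quotient, every `G`-invariant section of `X′` over `q⁻¹W` is pulled back from `W`.
[cite: MumfordAV1970, §7 Thm. p. 66 (2)] -/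
theorem isInvariant_app (h : ρ.IsGeometricQuotient q) (W : Q.Opens) :
    letI := (ActionOver.mk ρ.aut h.comp_eq).mulSemiringAction W
    letI := (q.app W).hom.toAlgebra
    Algebra.IsInvariant Γ(Q, W) Γ(X', q ⁻¹ᵁ W) G := by
  letI := (ActionOver.mk ρ.aut h.comp_eq).mulSemiringAction W
  letI := (q.app W).hom.toAlgebra
  refine ⟨fun b hb => ?_⟩
  obtain ⟨t, ht⟩ := h.exists_app_eq W b (fun g e => hb g)
  exact ⟨t, ht⟩

/-- Over a geometric quotient `q♯ : Γ(Q, W) → Γ(X′, q⁻¹W)` is injective (`FaithfulSMul`).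
[cite: MumfordAV1970, §7 Thm. p. 66 (2)] -/
theorem faithfulSMul_app (h : ρ.IsGeometricQuotient q) (W : Q.Opens) :
    letI := (q.app W).hom.toAlgebra
    FaithfulSMul Γ(Q, W) Γ(X', q ⁻¹ᵁ W) := by
  letI := (q.app W).hom.toAlgebra
  exact (faithfulSMul_iff_algebraMap_injective _ _).mpr (h.app_injective W)

/-- The action on `Γ(X′, q⁻¹W)` is `Γ(Q, W)`-linear: sections pulled back from `Q` are invariant.
[folklore] -/
theorem smulCommClass_app (hq : ∀ g : G, (ρ.aut g).hom ≫ q = q) (W : Q.Opens) :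
    letI := (ActionOver.mk ρ.aut hq).mulSemiringAction W
    letI := (q.app W).hom.toAlgebra
    SMulCommClass G Γ(Q, W) Γ(X', q ⁻¹ᵁ W) := by
  letI := (ActionOver.mk ρ.aut hq).mulSemiringAction W
  letI := (q.app W).hom.toAlgebra
  refine ⟨fun g a b => ?_⟩
  rw [Algebra.smul_def, Algebra.smul_def, smul_mul', RingHom.algebraMap_toAlgebra]
  congr 1
  exact (ActionOver.mk ρ.aut hq).act_app g W a

end Invariants

/-! ### Faithful actions move sections on every dense affine chart -/

section Faithful

variable [IsIntegral X'] [X'.IsSeparated]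

/-- **A non-trivial automorphism of the action moves some section over any non-empty affine
`G`-stable chart.** If `ρ.aut g ≠ 1` (e.g. `g ≠ 1` for a faithful action) and `q⁻¹W` is a
non-empty affine open of the integral separated `X′`, then `g` does not act as the identity on
`Γ(X′, q⁻¹W)`: otherwise `g⁻¹` restricted to the affine `q⁻¹W` is the identity (a morphism to an
affine scheme is determined by the map on global sections), so `g⁻¹` agrees with `𝟙` on a dense
open of the reduced `X′`, whence `g⁻¹ = 𝟙` as `X′` is separated. [folklore] -/
theorem act_ne_id (hq : ∀ g : G, (ρ.aut g).hom ≫ q = q) {W : Q.Opens}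
    (hW : IsAffineOpen (q ⁻¹ᵁ W)) (hne : ((q ⁻¹ᵁ W : X'.Opens) : Set X').Nonempty) {g : G}
    (hg : ρ.aut g ≠ 1) : (ActionOver.mk ρ.aut hq).act g W ≠ RingHom.id _ := by
  intro hid
  apply hg
  set O : X'.Opens := q ⁻¹ᵁ W with hO
  have hle : O ≤ (ρ.aut g⁻¹).hom ⁻¹ᵁ O := ((ActionOver.mk ρ.aut hq).preimage_preimage g⁻¹ W).ge
  -- the restriction of `g⁻¹` to the affine chart `O` is the identity
  set s : (O : Scheme.{u}) ⟶ O := (ρ.aut g⁻¹).hom.resLE O O hle with hs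
  have happ : (ρ.aut g⁻¹).hom.appLE O O hle = 𝟙 _ := by
    ext x
    exact congrArg (fun φ : Γ(X', q ⁻¹ᵁ W) →+* Γ(X', q ⁻¹ᵁ W) => φ x) hid
  haveI : IsAffine (O : Scheme.{u}) := hW
  have hs1 : s = 𝟙 _ := by
    apply ext_of_isAffine
    rw [Scheme.Hom.appTop, hs, Scheme.Hom.resLE_app_top, happ, Category.id_comp, Iso.hom_inv_id,
      Scheme.Hom.id_appTop]
  -- hence `g⁻¹` agrees with `𝟙` on the dense open `O`
  have hι : O.ι ≫ (ρ.aut g⁻¹).hom = O.ι ≫ 𝟙 X' := by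
    rw [Category.comp_id, ← Scheme.Hom.resLE_comp_ι (ρ.aut g⁻¹).hom hle, ← hs, hs1,
      Category.id_comp]
  haveI : IsDominant O.ι := ⟨by rw [DenseRange, Scheme.Opens.range_ι]; exact O.2.dense hne⟩
  have hinv : (ρ.aut g⁻¹).hom = 𝟙 X' := ext_of_isDominant O.ι hι
  have h1 : ρ.aut g⁻¹ = 1 := by
    ext : 1
    exact hinv
  rw [map_inv, inv_eq_one] at h1
  exact h1

end Faithful

/-! ### A free invariant chart -/

section FreeChart

variable [IsIntegral X'] [X'.IsSeparated] [Finite G]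

/-- **An invariant section in all augmentation ideals.** For a faithful action of the finite group
`G` on the integral separated `X′` and a non-empty affine chart `q⁻¹W`, there is a non-zero
`G`-invariant section `b₀ ∈ Γ(X′, q⁻¹W)` lying in every augmentation ideal
`I_g = (g • b - b : b)`, `g ≠ 1`: each `g ≠ 1` moves some `b_g` (`act_ne_id`); take
`c = ∏_{g ≠ 1} (g • b_g - b_g) ≠ 0` (a domain) and its norm `b₀ = ∏_{h ∈ G} h • c`. [folklore] -/
theorem exists_invariant_mem_augIdeal (hq : ∀ g : G, (ρ.aut g).hom ≫ q = q)
    (hinj : Function.Injective ρ.aut) {W : Q.Opens} (hW : IsAffineOpen (q ⁻¹ᵁ W))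
    (hne : ((q ⁻¹ᵁ W : X'.Opens) : Set X').Nonempty) :
    letI := (ActionOver.mk ρ.aut hq).mulSemiringAction W
    ∃ b₀ : Γ(X', q ⁻¹ᵁ W), b₀ ≠ 0 ∧ (∀ g : G, g • b₀ = b₀) ∧
      ∀ g : G, g ≠ 1 → b₀ ∈ Ideal.span (Set.range fun b : Γ(X', q ⁻¹ᵁ W) => g • b - b) := by
  letI := (ActionOver.mk ρ.aut hq).mulSemiringAction W
  classical
  let _ : Fintype G := Fintype.ofFinite G
  haveI : Nonempty (q ⁻¹ᵁ W : X'.Opens) := hne.to_subtype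
  -- each `g ≠ 1` moves some section
  have hmove : ∀ g : {g : G // g ≠ 1}, ∃ b : Γ(X', q ⁻¹ᵁ W), g.1 • b - b ≠ 0 := by
    rintro ⟨g, hg⟩
    by_contra hall
    push Not at hall
    refine act_ne_id ρ hq hW hne (g := g) (fun h1 => hg (hinj (h1.trans (map_one ρ.aut).symm))) ?_
    ext b
    have hb := hall b
    rw [sub_eq_zero] at hb
    exact hb
  choose f hf using hmove
  set c : Γ(X', q ⁻¹ᵁ W) := ∏ g : {g : G // g ≠ 1}, (g.1 • f g - f g) with hc
  have hc0 : c ≠ 0 := Finset.prod_ne_zero_iff.mpr fun g _ => hf g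
  have hcmem : ∀ g : G, g ≠ 1 →
      c ∈ Ideal.span (Set.range fun b : Γ(X', q ⁻¹ᵁ W) => g • b - b) := by
    intro g hg
    rw [hc, ← Finset.mul_prod_erase Finset.univ (fun g' : {g : G // g ≠ 1} => g'.1 • f g' - f g')
      (Finset.mem_univ ⟨g, hg⟩)]
    exact Ideal.mul_mem_right _ _ (Ideal.subset_span ⟨f ⟨g, hg⟩, rfl⟩)
  refine ⟨∏ h : G, h • c, ?_, fun g => Finset.smul_prod_perm c g, fun g hg => ?_⟩
  · exact Finset.prod_ne_zero_iff.mpr fun h _ => (smul_ne_zero_iff_ne h).mpr hc0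
  · rw [← Finset.mul_prod_erase Finset.univ (fun h : G => h • c) (Finset.mem_univ 1), one_smul]
    exact Ideal.mul_mem_right _ _ (hcmem g hg)

omit [IsIntegral X'] [X'.IsSeparated] [Finite G] in
/-- **Freeness on the basic open of an invariant element of the augmentation ideal.** If
`q♯ a₀` lies in the augmentation ideal `I_g` of `Γ(X′, q⁻¹W)`, then on `q⁻¹D(a₀) = D(q♯ a₀)` the
augmentation ideal `I_g` is the unit ideal: it contains the restriction of `q♯ a₀`, a unit.
[folklore] -/
theorem augIdeal_basicOpen_eq_top (hq : ∀ g : G, (ρ.aut g).hom ≫ q = q) {W : Q.Opens}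
    (a₀ : Γ(Q, W)) {g : G}
    (hmem : letI := (ActionOver.mk ρ.aut hq).mulSemiringAction W
      q.app W a₀ ∈ Ideal.span (Set.range fun b : Γ(X', q ⁻¹ᵁ W) => g • b - b)) :
    letI := (ActionOver.mk ρ.aut hq).mulSemiringAction (Q.basicOpen a₀)
    Ideal.span (Set.range fun b : Γ(X', q ⁻¹ᵁ Q.basicOpen a₀) => g • b - b) = ⊤ := by
  letI := (ActionOver.mk ρ.aut hq).mulSemiringAction W
  letI := (ActionOver.mk ρ.aut hq).mulSemiringAction (Q.basicOpen a₀)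
  have hle : Q.basicOpen a₀ ≤ W := Q.basicOpen_le a₀
  let r : Γ(X', q ⁻¹ᵁ W) →+* Γ(X', q ⁻¹ᵁ Q.basicOpen a₀) :=
    (X'.presheaf.map (homOfLE (q.preimage_mono hle)).op).hom
  -- `r (q♯ a₀) = q♯ (a₀|_{D(a₀)})` is a unit
  have hunit : IsUnit (r (q.app W a₀)) := by
    have e : r (q.app W a₀) = q.app (Q.basicOpen a₀) (Q.presheaf.map (homOfLE hle).op a₀) := by
      change (q.app W ≫ X'.presheaf.map (homOfLE (q.preimage_mono hle)).op) a₀ =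
        (Q.presheaf.map (homOfLE hle).op ≫ q.app (Q.basicOpen a₀)) a₀
      rw [q.naturality (homOfLE hle).op]
      rfl
    rw [e]
    exact (Q.toRingedSpace.isUnit_res_basicOpen a₀).map _
  -- `r` maps `I_g(W)` into `I_g(D(a₀))`
  have hmap : Ideal.map r (Ideal.span (Set.range fun b : Γ(X', q ⁻¹ᵁ W) => g • b - b)) ≤
      Ideal.span (Set.range fun b : Γ(X', q ⁻¹ᵁ Q.basicOpen a₀) => g • b - b) := by
    rw [Ideal.map_span]
    apply Ideal.span_mono
    rintro _ ⟨_, ⟨b, rfl⟩, rfl⟩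
    refine ⟨r b, ?_⟩
    change g • r b - r b = r (g • b - b)
    rw [map_sub]
    congr 1
    exact ((ActionOver.mk ρ.aut hq).map_act hle g b).symm
  exact Ideal.eq_top_of_isUnit_mem _ (hmap (Ideal.mem_map_of_mem r hmem)) hunit

end FreeChart

/-! ### Étaleness over the free chart -/

section Etale

variable [Finite G]

/-- **`q♯` is étale over a chart where the action is free** (Chase–Harrison–Rosenberg / SGA 1,
V, Prop. 2.6, `Literature.RingTheory.GaloisAlgebras.etale_of_free`): over a geometric quotient,
`Γ(Q, W) → Γ(X′, q⁻¹W)` is the inclusion of the invariants (`isInvariant_app`,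
`faithfulSMul_app`), so if all augmentation ideals `I_g`, `g ≠ 1`, of `Γ(X′, q⁻¹W)` are the unit
ideal then it is étale. [cite: SGA1, Exp. V, Prop. 2.6] -/
theorem etale_app_of_free (h : ρ.IsGeometricQuotient q) (W : Q.Opens)
    (hfree : letI := (ActionOver.mk ρ.aut h.comp_eq).mulSemiringAction W
      ∀ g : G, g ≠ 1 → Ideal.span (Set.range fun b : Γ(X', q ⁻¹ᵁ W) => g • b - b) = ⊤) :
    (q.app W).hom.Etale := by
  letI := (ActionOver.mk ρ.aut h.comp_eq).mulSemiringAction W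
  letI := (q.app W).hom.toAlgebra
  let _ : Fintype G := Fintype.ofFinite G
  haveI := isInvariant_app ρ h W
  haveI := faithfulSMul_app ρ h W
  haveI := smulCommClass_app ρ h.comp_eq W
  have hE : Algebra.Etale Γ(Q, W) Γ(X', q ⁻¹ᵁ W) :=
    etale_of_free' Γ(Q, W) G hfree
  exact hE

/-- `q ∣_ W` is étale for an affine `W` with affine preimage over which `q♯` is étale (the scheme
property `Etale` is the ring-hom property on affine pieces). [folklore] -/
theorem etale_morphismRestrict_of_etale_app {W : Q.Opens} (hW : IsAffineOpen W)
    (hW' : IsAffineOpen (q ⁻¹ᵁ W)) (het : ∀ V : Q.Opens, V = W → (q.app V).hom.Etale) :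
    Etale (q ∣_ W) := by
  haveI : IsAffine (W : Scheme.{u}) := hW
  haveI : IsAffine (q ⁻¹ᵁ W : Scheme.{u}) := hW'
  rw [HasRingHomProperty.iff_of_isAffine (P := @Etale), morphismRestrict_appTop]
  exact (RingHom.Etale.respectsIso.cancel_right_isIso _ _).mpr (het _ W.ι_image_top)

end Etale

/-! ### The quotient map is generically étale -/

section Main

variable [IsIntegral X'] [X'.IsSeparated] [Finite G]

/-- **A finite geometric quotient of an integral separated scheme by a faithful action of a finite
group is étale over a dense open of the quotient** (SGA 1, Exp. V, Cor. 2.4 / Prop. 2.6 at the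
generic point, whose inertia is trivial for a faithful action): with `W ⊆ Q` a non-empty affine
open, `b₀ = q♯ a₀` the invariant section of `exists_invariant_mem_augIdeal`, the action is free
over `D(a₀)` (`augIdeal_basicOpen_eq_top`), so `q` is étale over the non-empty — hence dense, `Q`
being irreducible as the image of `X′` — open `D(a₀)`. [cite: SGA1, Exp. V, Prop. 2.6] -/
theorem exists_dense_etale_morphismRestrict (h : ρ.IsGeometricQuotient q) [IsAffineHom q]
    (hinj : Function.Injective ρ.aut) :
    ∃ U : Q.Opens, Dense (U : Set Q) ∧ Etale (q ∣_ U) := by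
  classical
  -- `Q` is irreducible, being the image of `X′`
  haveI : PreirreducibleSpace Q := by
    refine ⟨?_⟩
    have himg : (q : X' → Q) '' Set.univ = Set.univ :=
      Set.image_univ_of_surjective h.surjective
    rw [← himg]
    exact (PreirreducibleSpace.isPreirreducible_univ (X := X')).image _
      q.continuous.continuousOn
  -- a non-empty affine chart
  obtain ⟨x'⟩ := (inferInstance : Nonempty X')
  obtain ⟨y, hy⟩ := Q.affineCover.covers (q x')
  let W : Q.Opens := (Q.affineCover.f (Q.affineCover.idx (q x'))).opensRange
  have hWaff : IsAffineOpen W := isAffineOpen_opensRange _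
  have hW'aff : IsAffineOpen (q ⁻¹ᵁ W) := hWaff.preimage q
  have hne : ((q ⁻¹ᵁ W : X'.Opens) : Set X').Nonempty := ⟨x', ⟨y, hy⟩⟩
  letI := (ActionOver.mk ρ.aut h.comp_eq).mulSemiringAction W
  obtain ⟨b₀, hb0, hinv, hmem⟩ := exists_invariant_mem_augIdeal ρ h.comp_eq hinj hW'aff hne
  -- `b₀` descends to `a₀`
  obtain ⟨a₀, ha₀⟩ := h.exists_app_eq W b₀ (fun g e => hinv g)
  refine ⟨Q.basicOpen a₀, ?_, ?_⟩
  · -- non-empty, hence dense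
    refine (Q.basicOpen a₀).2.dense ?_
    have hb : X'.basicOpen b₀ ≠ ⊥ := by
      rw [Ne, basicOpen_eq_bot_iff]
      exact hb0
    obtain ⟨x, hx⟩ := ((X'.basicOpen b₀).ne_bot_iff_nonempty).mp hb
    refine ⟨q x, ?_⟩
    have : x ∈ q ⁻¹ᵁ Q.basicOpen a₀ := by
      rw [Scheme.preimage_basicOpen, ha₀]
      exact hx
    exact this
  · refine etale_morphismRestrict_of_etale_app (hWaff.basicOpen a₀) ((hWaff.basicOpen a₀).preimage q) ?_
    rintro V rfl
    refine etale_app_of_free ρ h _ fun g hg => augIdeal_basicOpen_eq_top ρ h.comp_eq a₀ ?_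
    rw [ha₀]
    exact hmem g hg

end Main

end Summit.ResolutionOfSingularities.ResolutionOfSingularities.Theorems

end
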